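import Summits.QuantumFields.YangMills.Theorems.BalabanUVNodesN22W1YoungLipschitzOfCouplingHolo
import Summits.QuantumFields.YangMills.Theorems.BalabanUVNodesN22AtRateRecord12Fixed

/-!
# BalabanUVNodes ∕ node N22 = NE9 — FADING MEMORY FROM AGE-GROWING COUPLING RADII: the located LETTER behind node N22's MEMORY HALF on the
# analytic road, and node N22's statement SHAPE `NE9 ∧ FadingMemory` for the W1 history functional from ONE activity-level complex-coupling
# datum («(2.38) on the young-coupling margin», module J31) whose radii GROW GEOMETRICALLY IN THE AGE of the coupling

Cell `pub-ymgap`, HUMAN RULING D-0062 (Track A) ∕ D-0149, WIDTH SEAT `pub-ymgap-dag-n22-w1` (harness re-seat g2) on node n22 = NE9; `--kind proof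
--supports stmt-QuantumFields-20544 --as helper` (K3⁷ `SpineGivenEndpointR13SepCoPH`), COUNT-NEUTRAL.  The piece «J31-downstream» handed to this seat by
the lane owner dag-n22-c g12 (pub-ymgap INBOX l.28841 «OFFER-1 = GO, yours»).  THEOREMS ONLY (0 `def`, 0 `sorry`, standard axioms); imports dag-n22-c's
module J31 `…Theorems.BalabanUVNodesN22W1YoungLipschitzOfCouplingHolo` (p605695) and dag-n22-e's `…Theorems.BalabanUVNodesN22AtRateRecord12Fixed` (for the
stage-free `YMDAG.N22.ne9_of_moduli_le`) BY NAME — through it dag-n22-c g0's Road-1 knit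
`…N22W1YoungLipschitz` (`YMDAG.N22.W1.ne9_and_fadingMemory_functionalOn_of_youngLipschitz`), node00-def-W1's OBJECT `Node00.HistoryTermsOfRecord` and RR-1's
letter block `Node00.U3Letters₁₁` (`moduli k i = C₉·ω^{k−i}`, `Node00/RateRecord11`).

WHY.  On the analytic road the history moduli of node N22's `T4OutputRate.NE9` are CAUCHY CONSTANTS: J31 (`youngLipschitz_of_coordHolo`) turns «(2.38) on
the young-coupling margin» — holomorphy of the step activities `t ↦ H(Z; g|g_i := t; φ)` on closed `ρ_i`-discs about the `i`-th coupling interval with the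
(2.38) amplitude `A·e^{−R d_{k+1}(Z)}` — into W1's `YoungLipschitz` slot with the table `4A∕ρ_i`.  The tree records twice that such a table carries NO
decay in the age `k+1−i` when the radii are uniform (`T4CouplingAnalyticity` §1: «The moduli are UNIFORM iff the radii are; NO decay in j − i comes out of
this»), whereas node N22's statement of record asks the MEMORY HALF `FadingMemory C₉ ω Λ` (`0 ≤ Λ k i ≤ C₉·ω^{k−i}`) and K3⁷ v5's `∃ ℓ` pins the moduli to a
letter block's GEOMETRIC table `ℓ.moduli k i = ℓ.C₉·ℓ.ω^{k−i}` (`RateRecord11.U3Letters₁₁.moduli`).  THIS MODULE types the located letter that closes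
the gap on this road: the Cauchy table fades EXACTLY WHEN the analyticity radius in a coupling grows geometrically with its AGE,
`ρ k i ≥ ϱ·ω^{−(k−i)}` — «the older the coupling, the larger the complex neighbourhood on which the step-`k` activities are holomorphic in it with the same
(2.38) amplitude» — and then J31 ∘ dag-n22-c g0's Road-1 knit give node N22's SHAPE `NE9 ∧ FadingMemory` for `W1.functionalOn S p emb` from that ONE datum.
NOT PRINTED: print types «C^∞ (or analytic)» in the LAST coupling only ([I] p. 263), «analytic functions of the effective coupling constants» under the
alternative cut-off (p. 266), with NO radius anywhere; the growth letter is a cell hypothesis displayed as such, asserted nowhere.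

VERTEX-AWARENESS (binding honest label; J31's header, `T4CouplingAnalyticity` (L5)∕[H-dil], the cell's vertex verdict pv10).  Read at age ONE (`i = k` for
the step-`k` data, level `k+1`) the growth letter asks a UNIFORM margin `ϱ·ω^{−1}` in the LAST coupling on the whole interval `]0, γ]` — in the printed
scheme the last coupling is a dilation parameter of the step's integration variables and NO `g`-independent margin is claimed at the vertex `g → 0`.  §2's
box edition therefore DISPLAYS that margin as a hypothesis (exactly as J31's box edition does); it is asserted nowhere.  A consumer who keeps the last
coordinate off the vertex uses J31's general-interval edition `youngLipschitz_of_coordHolo` with §1 unchanged (§1 is interval-blind).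

WHAT (all [folklore] unless cited).
* §1 `fadingMemory_of_couplingRadii` — GENERIC: a radius table with `ϱ·(ω^{k−i})⁻¹ ≤ ρ k i` (`i ≤ k`; `0 < ϱ`, `0 < ω`) ⟹
  `FadingMemory (4A∕ϱ) ω (fun k i ↦ 4A∕ρ k i)` (`A ≥ 0`); `fadingMemory_cauchyTable_geomRadii` (the table `ρ k i := ϱ·(ω^{k−i})⁻¹` itself);
  `couplingRadii_of_fadingCauchyTable` (CONVERSELY: if the Cauchy table `4A∕ρ` is dominated by a geometric table `C₉·ω^{k−i}` with `A > 0`, the radii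
  grow: `(4A∕C₉)·(ω^{k−i})⁻¹ ≤ ρ k i`) — fading of the Cauchy moduli ⟺ age-growing radii; `fadingMemory_of_couplingRadii_lastLetter` (VERTEX-AWARE
  edition for dag-n22-c's J31b table `fun i ↦ if i < k then 4A∕ρ i else L`: growing radii in the OLDER couplings only, a letter `L` at age one,
  `0 < ω ≤ 1` ⟹ `FadingMemory (max (4A∕ϱ) (L∕ω)) ω`).
* §2 ★ `ne9_and_fadingMemory_functionalOn_of_coordHoloRadii` — for W1's cluster tower `S` on the `K`-th torus, backgrounds read inside the space tables,
  Road 1's numerals (`κ ≤ r₁`, `r₁ + 2·64·log 162 + 2 ≤ R`, `2A·e^{5r₁+1}·K₀(64,8)·9·64 ≤ 1`, `A > 0`), a radius table `ρ : ℕ → ℕ → ℝ` GROWING WITH THE AGE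
  (`ϱ·(ω^{k−i})⁻¹ ≤ ρ k i`) and J31's margin datum at every level `k` on the box `]0, γ]^{k+1}` with radii `ρ (k+1) ·`:
  `NE9 (W1.functionalOn S p emb) (Window γ) κ Λ ∧ FadingMemory (c·(4A∕ϱ)) ω Λ`, `Λ k i = c·(4A∕ρ k i)`, `c = 8·e·9·64·K₀(64,8)²` — J31
  `bound238_box_of_coordHolo` ∕ `youngLipschitz_box_of_coordHolo` ∘ §1 ∘ dag-n22-c g0 `ne9_and_fadingMemory_functionalOn_of_youngLipschitz` BY NAME;
  `ne9_and_fadingMemory_functional_of_coordHoloRadii` (the functional of record, `emb := Sect2.ofBackgroundC ι`).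
* §3 THE K3⁷-FACING MODULI JUNCTION (pure arithmetic): `scaledCauchyModuli_le_letterModuli` — a letter block `ℓ : U3Letters₁₁` DOMINATES the scaled
  Cauchy table `C·(4A∕ρ k i) ≤ ℓ.moduli k i` as soon as the radii grow against `ℓ.ω` at rate `ϱ` with `C·(4A∕ϱ) ≤ ℓ.C₉` — the shape in which a pin face
  with letter domination (dag-n22-w2 g3 ∕ dag-n22-w3 g3, (t8)) reads the engine constants of the (β′) letter; `letterModuli_le_iff_radii` — at ONE entry,
  domination by `ℓ.moduli` ⟺ the radius inequality (so a letter block with `ℓ.ω < 1` — `U3Letters₁₁.Signs` — forces age-growing radii on this road).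
* §3b ★ `ne9_functionalOn_letterModuli_of_coordHoloRadii` — THE K3⁷-SHAPED FACE: §2 + §3 + dag-n22-e's `YMDAG.N22.ne9_of_moduli_le` (monotonicity of `NE9` in the moduli, `…N22AtRateRecord12Fixed` BY NAME) ⟹
  `NE9 (W1.functionalOn S p emb) (Window γ) κ ℓ.moduli` with the letter block's geometric moduli ON THE NOSE (radii growing against `ℓ.ω`, `c·(4A∕ϱ) ≤ ℓ.C₉`).
* §4 RIDER (A5): `coordHoloRadii_termlessTower` — the hypotheses of §2 other than the numerals are jointly satisfiable (termless MODEL tower, `Hc ≡ 0`,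
  `O = ℂ`, any radius table), and `ne9_and_fadingMemory_termlessTower` — §2 FIRES there; a model tower, NOT NODE 00's.

HONEST FRAMING.  Count-neutral helper ∕ junction; by-name composition + real arithmetic.  DISPLAYED (hypotheses, asserted nowhere): J31's margin datum at
the towers (node N10's Lemma 3 complexified in the couplings ∕ NODE A at the towers of record) and the NEW located letter «radius growth in the age»
(no owner in print; the cell's memory half on the analytic road).  Nothing of Bałaban's is constructed; N22 NOT discharged (typed 28∕28 · discharged 5∕27
UNCHANGED — the chair's single count line is the only count); K3⁷ OPEN, NOT claimed; NE9 ∕ `FadingMemory` NOT IN PRINT for d = 4; one finite four-torus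
programme at fixed ε — R4 closes the CONDITIONAL rung `BalabanLadder.UV` only; NOT infinite volume, NOT OS on ℝ⁴, NOT a mass gap, NOT Clay.

References (TYPES only): [I] = [Balaban1987RG1] T. Bałaban, Commun. Math. Phys. **109** (1987) 249–301 — §0 p. 256, §1 p. 263 («C^∞ … (or analytic)»),
§2 p. 266, §5 p. 298; [II] = [Balaban1988RG2Cluster] T. Bałaban, Commun. Math. Phys. **116** (1988) 1–22 — (2.11)–(2.14) pp. 14–15, Lemma 3 (2.38) p. 20,
(2.39)–(2.41) p. 21; the Cauchy mechanism as typed in `Dimock2015.AnalyticLipschitz` ([DimockYuan2024GNFlow] proof of Thm 4).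
-/

noncomputable section

namespace YMDAG.N22.W1.CouplingRadii

open Set Metric
open scoped BigOperators
open Literature.MathematicalPhysics.QuantumFieldTheory.Balaban1983to89
open Literature.MathematicalPhysics.QuantumFieldTheory.Balaban1983to89.T4Continuum (T4Family)
open Literature.MathematicalPhysics.QuantumFieldTheory.Balaban1983to89.T4OutputRate
open Literature.MathematicalPhysics.QuantumFieldTheory.Balaban1983to89.B12TreeDecay (K₀ K₀_pos)
open Literature.MathematicalPhysics.QuantumFieldTheory.Balaban1983to89.Node00
open Literature.MathematicalPhysics.QuantumFieldTheory.Balaban1983to89.Node00.Sect2 (domSys CPair ofBackgroundC)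
open Literature.MathematicalPhysics.QuantumFieldTheory.Balaban1983to89.Node00.W1
open YMDAG.N22.W1 (ne9_and_fadingMemory_functionalOn_of_youngLipschitz bound238_box_of_coordHolo youngLipschitz_box_of_coordHolo coordHolo_termlessStep
  box_eq_setOf_mem_Ioc)

/-! ## §1 GENERIC: fading of the Cauchy table ⟺ radii growing geometrically with the age -/

/-- **FADING MEMORY = AGE-GROWING COUPLING RADII.**  If the analyticity radius of the step-`k` objects in the coupling of age `k − i` dominates
`ϱ·ω^{−(k−i)}` (`0 < ϱ`, `0 < ω`, `i ≤ k`), the Cauchy moduli `4A∕ρ k i` (J31's table; `A ≥ 0`) FADE: `FadingMemory (4A∕ϱ) ω (fun k i ↦ 4A∕ρ k i)`.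
With UNIFORM radii (`ω = 1`) this is `FadingMemory (4A∕ϱ) 1` — no decay in the age, as `T4CouplingAnalyticity` §1 records. [folklore] -/
theorem fadingMemory_of_couplingRadii {A ϱ ω : ℝ} {ρ : ℕ → ℕ → ℝ} (hA : 0 ≤ A) (hϱ : 0 < ϱ) (hω : 0 < ω)
    (hρ : ∀ k i, i ≤ k → ϱ * (ω ^ (k - i))⁻¹ ≤ ρ k i) :
    FadingMemory (4 * A / ϱ) ω (fun k i => 4 * A / ρ k i) := by
  intro k i hi
  have hlow : 0 < ϱ * (ω ^ (k - i))⁻¹ := mul_pos hϱ (inv_pos.2 (pow_pos hω _))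
  have hρpos : 0 < ρ k i := hlow.trans_le (hρ k i hi)
  refine ⟨div_nonneg (by positivity) hρpos.le, ?_⟩
  calc 4 * A / ρ k i ≤ 4 * A / (ϱ * (ω ^ (k - i))⁻¹) := div_le_div_of_nonneg_left (by positivity) hlow (hρ k i hi)
    _ = 4 * A / ϱ * ω ^ (k - i) := by field_simp

/-- The GEOMETRIC radius table `ρ k i := ϱ·ω^{−(k−i)}` itself carries the fading Cauchy table (§1 at `le_rfl`), and its moduli are EXACTLY
`(4A∕ϱ)·ω^{k−i}`. [folklore] -/
theorem fadingMemory_cauchyTable_geomRadii {A ϱ ω : ℝ} (hA : 0 ≤ A) (hϱ : 0 < ϱ) (hω : 0 < ω) :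
    FadingMemory (4 * A / ϱ) ω (fun k i => 4 * A / (ϱ * (ω ^ (k - i))⁻¹)) ∧
      ∀ k i, 4 * A / (ϱ * (ω ^ (k - i))⁻¹) = 4 * A / ϱ * ω ^ (k - i) := by
  refine ⟨fadingMemory_of_couplingRadii (ρ := fun k i => ϱ * (ω ^ (k - i))⁻¹) hA hϱ hω fun k i _ => le_rfl, fun k i => ?_⟩
  have : ω ^ (k - i) ≠ 0 := pow_ne_zero _ hω.ne'
  field_simp

/-- **CONVERSELY: A FADING CAUCHY TABLE FORCES AGE-GROWING RADII.**  If at one entry the Cauchy modulus `4A∕ρ k i` (`A > 0`, `ρ k i > 0`) is dominated by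
a geometric bound `C₉·ω^{k−i}` (`ω > 0`), then `(4A∕C₉)·(ω^{k−i})⁻¹ ≤ ρ k i` — on the analytic road, memory decay in the age IS radius growth in the age.
[folklore] -/
theorem couplingRadii_of_fadingCauchyTable {A C₉ ω : ℝ} {ρ : ℕ → ℕ → ℝ} (hA : 0 < A) (hω : 0 < ω) {k i : ℕ} (hρ : 0 < ρ k i)
    (h : 4 * A / ρ k i ≤ C₉ * ω ^ (k - i)) : 4 * A / C₉ * (ω ^ (k - i))⁻¹ ≤ ρ k i := by
  have hωp : 0 < ω ^ (k - i) := pow_pos hω _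
  have h4A : 0 < 4 * A := by positivity
  -- `C₉ ω^{k−i} > 0` since it dominates the positive modulus
  have hCω : 0 < C₉ * ω ^ (k - i) := (div_pos h4A hρ).trans_le h
  have hC₉ : 0 < C₉ := pos_of_mul_pos_left hCω hωp.le
  -- `4A ≤ C₉ ω^{k−i} · ρ`, i.e. `4A ∕ (C₉ ω^{k−i}) ≤ ρ`
  have h1 : 4 * A ≤ C₉ * ω ^ (k - i) * ρ k i := by
    have := (div_le_iff₀ hρ).1 h
    linarith
  calc 4 * A / C₉ * (ω ^ (k - i))⁻¹ = 4 * A / (C₉ * ω ^ (k - i)) := by field_simp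
    _ ≤ ρ k i := (div_le_iff₀' hCω).2 (by linarith)

/-- **VERTEX-AWARE EDITION: AGE-GROWING RADII IN THE OLDER COUPLINGS ONLY, A LETTER AT AGE ONE.**  On dag-n22-c's vertex road (module J31b,
`…N22W1YoungLipschitzOfCouplingHoloVertex`) the LAST coupling of the step data (age one at the next level) carries NO `g`-independent margin but a Lipschitz
LETTER `L` from RELATIVE discs (`8A′∕min(c,1)`), and the young-Lipschitz table reads `fun i ↦ if i < k then 4A∕ρ i else L` at level `k+1`.  If the radii of
the OLDER couplings (age `≥ 2`) grow with the age, `ϱ·(ω^{k−i})⁻¹ ≤ ρ k i` for `i + 1 < k`, and `0 < ω ≤ 1`, `L ≥ 0`, that mixed table FADES: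
`FadingMemory (max (4A∕ϱ) (L∕ω)) ω (fun k i ↦ if i + 1 < k then 4A∕ρ k i else L)` — so J31b's ★ composes with dag-n22-c g0's
`ne9_and_fadingMemory_functionalOn_of_youngLipschitz` exactly as §2 below does with J31. [folklore] -/
theorem fadingMemory_of_couplingRadii_lastLetter {A ϱ ω L : ℝ} {ρ : ℕ → ℕ → ℝ} (hA : 0 ≤ A) (hϱ : 0 < ϱ) (hω : 0 < ω) (hω1 : ω ≤ 1)
    (hL : 0 ≤ L) (hρ : ∀ k i, i + 1 < k → ϱ * (ω ^ (k - i))⁻¹ ≤ ρ k i) :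
    FadingMemory (max (4 * A / ϱ) (L / ω)) ω (fun k i => if i + 1 < k then 4 * A / ρ k i else L) := by
  intro k i hi
  have hωp : 0 < ω ^ (k - i) := pow_pos hω _
  have hmax0 : 0 ≤ max (4 * A / ϱ) (L / ω) := le_max_of_le_left (div_nonneg (by positivity) hϱ.le)
  by_cases h : i + 1 < k
  · -- an OLDER coupling: the Cauchy entry under the growing radius
    have hlow : 0 < ϱ * (ω ^ (k - i))⁻¹ := mul_pos hϱ (inv_pos.2 hωp)
    have hρpos : 0 < ρ k i := hlow.trans_le (hρ k i h)
    simp only [if_pos h]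
    refine ⟨div_nonneg (by positivity) hρpos.le, ?_⟩
    calc 4 * A / ρ k i ≤ 4 * A / (ϱ * (ω ^ (k - i))⁻¹) := div_le_div_of_nonneg_left (by positivity) hlow (hρ k i h)
      _ = 4 * A / ϱ * ω ^ (k - i) := by field_simp
      _ ≤ max (4 * A / ϱ) (L / ω) * ω ^ (k - i) := mul_le_mul_of_nonneg_right (le_max_left _ _) hωp.le
  · -- age `k − i ∈ {0, 1}`: the letter `L`, and `ω^{k−i} ≥ ω`
    simp only [if_neg h]
    refine ⟨hL, ?_⟩
    have hki : k - i ≤ 1 := by omega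
    have hωki : ω ≤ ω ^ (k - i) := by
      rcases Nat.le_one_iff_eq_zero_or_eq_one.1 hki with e | e
      · rw [e, pow_zero]; exact hω1
      · rw [e, pow_one]
    calc L = L / ω * ω := by field_simp
      _ ≤ max (4 * A / ϱ) (L / ω) * ω := mul_le_mul_of_nonneg_right (le_max_right _ _) hω.le
      _ ≤ max (4 * A / ϱ) (L / ω) * ω ^ (k - i) := mul_le_mul_of_nonneg_left hωki hmax0

/-! ## §2 Node N22's statement SHAPE for the W1 functional from J31's margin datum with age-growing radii -/

section W1Functional
variable (F : T4Family) (K : ℕ) {𝔸 : Type*} {M : ℕ}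

open Classical in
/-- **★ `NE9 ∧ FadingMemory` FOR THE W1 HISTORY FUNCTIONAL FROM «(2.38) ON THE YOUNG-COUPLING MARGIN» WITH AGE-GROWING RADII.**  For W1's cluster tower `S`
on the `K`-th torus, backgrounds of `B` read in `Φ` through `emb` INSIDE the space tables, Road 1's numerals, and a radius table `ρ : ℕ → ℕ → ℝ` with
`ϱ·(ω^{k−i})⁻¹ ≤ ρ k i` (`i ≤ k`; `0 < ϱ`, `0 < ω`): IF at every level `k` the step activities carry J31's margin datum on the box `]0, γ]^{k+1}` with radii
`ρ (k+1) ·` — for every prefix `g`, polymer `Z`, configuration `φ ∈ sp k Z` and coordinate `i ≤ k`, a holomorphic extension of `t ↦ H(Z; g|g_i := t; φ)` to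
`O ⊇` the closed `ρ (k+1) i`-discs about `]0, γ]`, bounded by `A·e^{−R d_{k+1}(Z)}` on `O` — THEN node N22's statement shape holds for `W1.functionalOn S p emb`:
`NE9 … (Window γ) κ Λ ∧ FadingMemory (c·(4A∕ϱ)) ω Λ` with `Λ k i = c·(4A∕ρ k i)`, `c = 8·e·9·64·K₀(64,8)²`.  By name: J31 `bound238_box_of_coordHolo` ∕
`youngLipschitz_box_of_coordHolo` at every level, §1, dag-n22-c g0 `ne9_and_fadingMemory_functionalOn_of_youngLipschitz`.  VERTEX-AWARENESS: at `i = k` the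
datum asks the uniform margin `ρ (k+1) k ≥ ϱ·ω⁻¹` in the LAST coupling over `]0, γ]` — displayed, not claimed (module header).
[cite: Balaban1987RG1, §1 p.263, §2 p.266 and §5 p.298; Balaban1988RG2Cluster, (2.13) p.14, Lemma 3 (2.38) p.20 and (2.39)-(2.41) p.21] -/
theorem ne9_and_fadingMemory_functionalOn_of_coordHoloRadii (S : ClusterTower (F.P K) 𝔸 M) (p : RunPairing) {B : Type}
    (emb : B → CPair (F.P K) 𝔸) (sp : (k : ℕ) → (domSys (F.P K) M (k + 1)).Dom → Set (CPair (F.P K) 𝔸))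
    (hsp : ∀ (k : ℕ) (U : B) Z, emb U ∈ sp k Z) {γ κ A R r₁ ϱ ω : ℝ} (hA : 0 < A) (hr₁ : 0 ≤ r₁) (hκ : κ ≤ r₁)
    (hrate : r₁ + 2 * (64 * Real.log 162) + 2 ≤ R) (hsmall : 2 * A * Real.exp (5 * r₁ + 1) * K₀ 64 8 * 9 * 64 ≤ 1)
    (hϱ : 0 < ϱ) (hω : 0 < ω) (ρ : ℕ → ℕ → ℝ) (hρpos : ∀ k i, 0 < ρ k i) (hρ : ∀ k i, i ≤ k → ϱ * (ω ^ (k - i))⁻¹ ≤ ρ k i)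
    (hH : ∀ k, ∀ g ∈ box γ k, ∀ Z, ∀ φ ∈ sp k Z, ∀ i : Fin (k + 1),
      ∃ (Hc : ℂ → ℂ) (O : Set ℂ), DifferentiableOn ℂ Hc O ∧ (∀ t ∈ Ioc (0 : ℝ) γ, closedBall (t : ℂ) (ρ (k + 1) i) ⊆ O) ∧
        (∀ z ∈ O, ‖Hc z‖ ≤ A * Real.exp (-(R * (domSys (F.P K) M (k + 1)).dj Z))) ∧
        (∀ t ∈ Ioc (0 : ℝ) γ, Hc t = (S k).H (Function.update g i t) φ Z)) :
    NE9 (functionalOn S p emb) (Window γ) κ (fun n i => 8 * (Real.exp 1 * 9 * 64 * K₀ 64 8 ^ 2) * (4 * A / ρ n i)) ∧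
      FadingMemory (8 * (Real.exp 1 * 9 * 64 * K₀ 64 8 ^ 2) * (4 * A / ϱ)) ω
        (fun n i => 8 * (Real.exp 1 * 9 * 64 * K₀ 64 8 ^ 2) * (4 * A / ρ n i)) :=
  ne9_and_fadingMemory_functionalOn_of_youngLipschitz F K S p emb sp hsp (fun n i => 4 * A / ρ n i) hA hr₁ hκ hrate hsmall
    (fadingMemory_of_couplingRadii hA.le hϱ hω hρ)
    (fun k => bound238_box_of_coordHolo (S k) (sp k) (fun i => ρ (k + 1) i) (fun _ => hρpos _ _) (hH k))
    (fun k => youngLipschitz_box_of_coordHolo (S k) (sp k) (fun i => ρ (k + 1) i) (fun _ => hρpos _ _) (hH k))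

open Classical in
/-- **THE SAME FOR THE FUNCTIONAL OF RECORD `W1.functional S ι p`** (`emb := Sect2.ofBackgroundC ι`, the real `G`-valued gauge fields read in `Φ`).
[cite: Balaban1987RG1, (0.24) p.257, §1 p.263 and §5 p.298; Balaban1988RG2Cluster, (2.13) p.14 and (2.38) p.20] -/
theorem ne9_and_fadingMemory_functional_of_coordHoloRadii [Ring 𝔸] (S : ClusterTower (F.P K) 𝔸 M) {G : Type} [Group G] (ι : G →* 𝔸ˣ)
    (p : RunPairing) (sp : (k : ℕ) → (domSys (F.P K) M (k + 1)).Dom → Set (CPair (F.P K) 𝔸))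
    (hsp : ∀ (k : ℕ) (U : GaugeField (F.P K) 0 G) Z, ofBackgroundC ι U ∈ sp k Z) {γ κ A R r₁ ϱ ω : ℝ} (hA : 0 < A) (hr₁ : 0 ≤ r₁)
    (hκ : κ ≤ r₁) (hrate : r₁ + 2 * (64 * Real.log 162) + 2 ≤ R) (hsmall : 2 * A * Real.exp (5 * r₁ + 1) * K₀ 64 8 * 9 * 64 ≤ 1)
    (hϱ : 0 < ϱ) (hω : 0 < ω) (ρ : ℕ → ℕ → ℝ) (hρpos : ∀ k i, 0 < ρ k i) (hρ : ∀ k i, i ≤ k → ϱ * (ω ^ (k - i))⁻¹ ≤ ρ k i)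
    (hH : ∀ k, ∀ g ∈ box γ k, ∀ Z, ∀ φ ∈ sp k Z, ∀ i : Fin (k + 1),
      ∃ (Hc : ℂ → ℂ) (O : Set ℂ), DifferentiableOn ℂ Hc O ∧ (∀ t ∈ Ioc (0 : ℝ) γ, closedBall (t : ℂ) (ρ (k + 1) i) ⊆ O) ∧
        (∀ z ∈ O, ‖Hc z‖ ≤ A * Real.exp (-(R * (domSys (F.P K) M (k + 1)).dj Z))) ∧
        (∀ t ∈ Ioc (0 : ℝ) γ, Hc t = (S k).H (Function.update g i t) φ Z)) :
    NE9 (functional S ι p) (Window γ) κ (fun n i => 8 * (Real.exp 1 * 9 * 64 * K₀ 64 8 ^ 2) * (4 * A / ρ n i)) ∧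
      FadingMemory (8 * (Real.exp 1 * 9 * 64 * K₀ 64 8 ^ 2) * (4 * A / ϱ)) ω
        (fun n i => 8 * (Real.exp 1 * 9 * 64 * K₀ 64 8 ^ 2) * (4 * A / ρ n i)) :=
  ne9_and_fadingMemory_functionalOn_of_coordHoloRadii F K S p (ofBackgroundC ι) sp hsp hA hr₁ hκ hrate hsmall hϱ hω ρ hρpos hρ hH

end W1Functional

/-! ## §3 THE K3⁷-FACING MODULI JUNCTION: a letter block's geometric table vs the scaled Cauchy table (pure arithmetic) -/

/-- **A LETTER BLOCK DOMINATES THE SCALED CAUCHY TABLE WHEN THE RADII GROW AGAINST ITS RATE.**  For `ℓ : U3Letters₁₁` (`ℓ.moduli k i = ℓ.C₉·ℓ.ω^{k−i}`), a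
scale `C ≥ 0` (the (β′) letter's engine constant), amplitude `A ≥ 0`, and radii with `ϱ·(ℓ.ω^{k−i})⁻¹ ≤ ρ k i` (`0 < ϱ`, `0 < ℓ.ω`): if `C·(4A∕ϱ) ≤ ℓ.C₉` then
`C·(4A∕ρ k i) ≤ ℓ.moduli k i` for every `i ≤ k` — the letter-domination row a pin face with `ℓ.moduli` on the nose asks of the engine constants.
[cite: Balaban1987RG1, (1.20)-(1.22) p.264 (hypothesis dictionary: the geometric moduli shape is the consumers' letter, not a printed display)] -/
theorem scaledCauchyModuli_le_letterModuli (ℓ : U3Letters₁₁) {A ϱ C : ℝ} {ρ : ℕ → ℕ → ℝ} (hA : 0 ≤ A) (hC : 0 ≤ C) (hϱ : 0 < ϱ)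
    (hω : 0 < ℓ.ω) (hρ : ∀ k i, i ≤ k → ϱ * (ℓ.ω ^ (k - i))⁻¹ ≤ ρ k i) (hC₉ : C * (4 * A / ϱ) ≤ ℓ.C₉) {k i : ℕ} (hi : i ≤ k) :
    C * (4 * A / ρ k i) ≤ ℓ.moduli k i := by
  rw [U3Letters₁₁.moduli_apply]
  obtain ⟨-, h⟩ := fadingMemory_of_couplingRadii hA hϱ hω hρ k i hi
  calc C * (4 * A / ρ k i) ≤ C * (4 * A / ϱ * ℓ.ω ^ (k - i)) := mul_le_mul_of_nonneg_left h hC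
    _ = C * (4 * A / ϱ) * ℓ.ω ^ (k - i) := by ring
    _ ≤ ℓ.C₉ * ℓ.ω ^ (k - i) := mul_le_mul_of_nonneg_right hC₉ (pow_nonneg hω.le _)

/-- **AT ONE ENTRY, DOMINATION BY THE LETTER BLOCK ⟺ THE RADIUS INEQUALITY** (`C, A, ρ k i, ℓ.ω > 0`): `C·(4A∕ρ k i) ≤ ℓ.C₉·ℓ.ω^{k−i}` iff
`(4AC∕ℓ.C₉)·(ℓ.ω^{k−i})⁻¹ ≤ ρ k i` (and then `ℓ.C₉ > 0`).  So a letter block with the displayed signs (`ℓ.ω < 1`, `RateRecord11.U3Letters₁₁.Signs`) can carry the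
Cauchy moduli of the analytic road ONLY over radii growing geometrically in the age. [folklore] -/
theorem letterModuli_le_iff_radii (ℓ : U3Letters₁₁) {A C : ℝ} {ρ : ℕ → ℕ → ℝ} (hA : 0 < A) (hC : 0 < C) (hω : 0 < ℓ.ω) {k i : ℕ}
    (hρ : 0 < ρ k i) (hC₉ : 0 < ℓ.C₉) :
    C * (4 * A / ρ k i) ≤ ℓ.moduli k i ↔ 4 * A * C / ℓ.C₉ * (ℓ.ω ^ (k - i))⁻¹ ≤ ρ k i := by
  rw [U3Letters₁₁.moduli_apply]
  have hωp : 0 < ℓ.ω ^ (k - i) := pow_pos hω _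
  have hCω : 0 < ℓ.C₉ * ℓ.ω ^ (k - i) := mul_pos hC₉ hωp
  constructor
  · intro h
    -- `4AC ≤ C₉ ω^{k−i} ρ`
    have h1 : C * (4 * A) ≤ ℓ.C₉ * ℓ.ω ^ (k - i) * ρ k i := by
      have := (div_le_iff₀ hρ).1 (show C * (4 * A) / ρ k i ≤ ℓ.C₉ * ℓ.ω ^ (k - i) by rwa [mul_div_assoc])
      linarith
    calc 4 * A * C / ℓ.C₉ * (ℓ.ω ^ (k - i))⁻¹ = C * (4 * A) / (ℓ.C₉ * ℓ.ω ^ (k - i)) := by field_simp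
      _ ≤ ρ k i := (div_le_iff₀' hCω).2 (by linarith)
  · intro h
    have h1 : C * (4 * A) ≤ ℓ.C₉ * ℓ.ω ^ (k - i) * ρ k i := by
      have := (div_le_iff₀' hCω).1 (show C * (4 * A) / (ℓ.C₉ * ℓ.ω ^ (k - i)) ≤ ρ k i by
        rwa [show C * (4 * A) / (ℓ.C₉ * ℓ.ω ^ (k - i)) = 4 * A * C / ℓ.C₉ * (ℓ.ω ^ (k - i))⁻¹ by field_simp])
      linarith
    rw [mul_div_assoc', div_le_iff₀ hρ]
    linarith

/-! ## §3b THE K3⁷-SHAPED FACE: `NE9` of the W1 functional with a letter block's moduli on the nose -/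

section LetterFace
variable (F : T4Family) (K : ℕ) {𝔸 : Type*} {M : ℕ}

open Classical in
/-- **★ THE K3⁷-SHAPED FACE: `NE9` OF THE W1 FUNCTIONAL WITH A LETTER BLOCK's MODULI `ℓ.moduli = ℓ.C₉·ℓ.ω^{k−i}` ON THE NOSE.**  Under §2's hypotheses with the
radii growing against the block's rate `ℓ.ω` (`ϱ·(ℓ.ω^{k−i})⁻¹ ≤ ρ k i`) and the block's constant dominating the scaled Cauchy constant (`c·(4A∕ϱ) ≤ ℓ.C₉`,
`c = 8·e·9·64·K₀(64,8)²`): `NE9 (W1.functionalOn S p emb) (Window γ) κ ℓ.moduli` — the moduli currency of RR-1's `U3Letters₁₁` (node U3's letter block, the shape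
K3⁷ v5's `h9` reads at the kernel objects), by §2 + §3 + dag-n22-e's `YMDAG.N22.ne9_of_moduli_le` (`…N22AtRateRecord12Fixed`, BY NAME).  The block's other letters (`κ`-field, `θ₅`, `C₅`, `cr`, `ρ`) are
not read here (the rate is the numeral `κ ≤ r₁`). [cite: Balaban1987RG1, (1.18) p.263 and (1.20)-(1.22) p.264; Balaban1988RG2Cluster, (2.13) p.14 and (2.38) p.20] -/
theorem ne9_functionalOn_letterModuli_of_coordHoloRadii (S : ClusterTower (F.P K) 𝔸 M) (p : RunPairing) {B : Type}
    (emb : B → CPair (F.P K) 𝔸) (sp : (k : ℕ) → (domSys (F.P K) M (k + 1)).Dom → Set (CPair (F.P K) 𝔸))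
    (hsp : ∀ (k : ℕ) (U : B) Z, emb U ∈ sp k Z) {γ κ A R r₁ ϱ : ℝ} (hA : 0 < A) (hr₁ : 0 ≤ r₁) (hκ : κ ≤ r₁)
    (hrate : r₁ + 2 * (64 * Real.log 162) + 2 ≤ R) (hsmall : 2 * A * Real.exp (5 * r₁ + 1) * K₀ 64 8 * 9 * 64 ≤ 1)
    (ℓ : U3Letters₁₁) (hω : 0 < ℓ.ω) (hϱ : 0 < ϱ) (ρ : ℕ → ℕ → ℝ) (hρpos : ∀ k i, 0 < ρ k i)
    (hρ : ∀ k i, i ≤ k → ϱ * (ℓ.ω ^ (k - i))⁻¹ ≤ ρ k i) (hC₉ : 8 * (Real.exp 1 * 9 * 64 * K₀ 64 8 ^ 2) * (4 * A / ϱ) ≤ ℓ.C₉)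
    (hH : ∀ k, ∀ g ∈ box γ k, ∀ Z, ∀ φ ∈ sp k Z, ∀ i : Fin (k + 1),
      ∃ (Hc : ℂ → ℂ) (O : Set ℂ), DifferentiableOn ℂ Hc O ∧ (∀ t ∈ Ioc (0 : ℝ) γ, closedBall (t : ℂ) (ρ (k + 1) i) ⊆ O) ∧
        (∀ z ∈ O, ‖Hc z‖ ≤ A * Real.exp (-(R * (domSys (F.P K) M (k + 1)).dj Z))) ∧
        (∀ t ∈ Ioc (0 : ℝ) γ, Hc t = (S k).H (Function.update g i t) φ Z)) :
    NE9 (functionalOn S p emb) (Window γ) κ ℓ.moduli := by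
  have h := (ne9_and_fadingMemory_functionalOn_of_coordHoloRadii F K S p emb sp hsp hA hr₁ hκ hrate hsmall hϱ hω ρ hρpos hρ hH).1
  refine ne9_of_moduli_le (fun k i hi => ?_) h
  have hK : 0 < K₀ 64 8 := K₀_pos 64 8
  exact scaledCauchyModuli_le_letterModuli ℓ hA.le (by positivity) hϱ hω hρ hC₉ hi.le

end LetterFace

/-! ## §4 RIDER (A5): the hypotheses of §2 are jointly satisfiable, and §2 fires there -/

section Rider
variable (F : T4Family) (K : ℕ) {𝔸 : Type*} {M : ℕ}

/-- **THE MARGIN DATUM AT EVERY LEVEL OF THE TERMLESS MODEL TOWER** (each step `⟨PUnit, ∅, 0⟩`, so `H ≡ 0`; `Hc ≡ 0`, `O = ℂ`), for ANY radius table and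
any `A ≥ 0` — J31's rider `coordHolo_termlessStep` at the box intervals.  A model tower, NOT NODE 00's. [folklore] -/
theorem coordHoloRadii_termlessTower (sp : (k : ℕ) → (domSys (F.P K) M (k + 1)).Dom → Set (CPair (F.P K) 𝔸)) {γ A : ℝ} (hA : 0 ≤ A) (R : ℝ)
    (ρ : ℕ → ℕ → ℝ) :
    ∀ k, ∀ g ∈ box γ k, ∀ Z, ∀ φ ∈ sp k Z, ∀ i : Fin (k + 1),
      ∃ (Hc : ℂ → ℂ) (O : Set ℂ), DifferentiableOn ℂ Hc O ∧ (∀ t ∈ Ioc (0 : ℝ) γ, closedBall (t : ℂ) (ρ (k + 1) i) ⊆ O) ∧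
        (∀ z ∈ O, ‖Hc z‖ ≤ A * Real.exp (-(R * (domSys (F.P K) M (k + 1)).dj Z))) ∧
        (∀ t ∈ Ioc (0 : ℝ) γ, Hc t = (⟨PUnit, fun _ => ∅, fun _ _ _ => 0⟩ : ClusterStep (F.P K) 𝔸 M k).H (Function.update g i t) φ Z) := by
  intro k g hg Z φ hφ i
  rw [box_eq_setOf_mem_Ioc] at hg
  exact coordHolo_termlessStep (fun _ => Ioc (0 : ℝ) γ) (sp k) hA R (fun i => ρ (k + 1) i) g hg Z φ hφ i

open Classical in
/-- **§2 FIRES ON THE TERMLESS MODEL TOWER** with the geometric radius table `ρ k i := ϱ·(ω^{k−i})⁻¹` and backgrounds read anywhere (space tables `univ`):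
node N22's shape `NE9 ∧ FadingMemory` holds there with §2's constants (every term is `0`) — so §2 is not a vacuous implication.  Road 1's numerals stay
hypotheses (numerics; e.g. `r₁ = 0`, `R = 2·64·log 162 + 2`, `A` small). [folklore] -/
theorem ne9_and_fadingMemory_termlessTower (p : RunPairing) {B : Type} (emb : B → CPair (F.P K) 𝔸) {γ κ A R r₁ ϱ ω : ℝ} (hA : 0 < A)
    (hr₁ : 0 ≤ r₁) (hκ : κ ≤ r₁) (hrate : r₁ + 2 * (64 * Real.log 162) + 2 ≤ R) (hsmall : 2 * A * Real.exp (5 * r₁ + 1) * K₀ 64 8 * 9 * 64 ≤ 1)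
    (hϱ : 0 < ϱ) (hω : 0 < ω) :
    NE9 (functionalOn (M := M) (fun k => (⟨PUnit, fun _ => ∅, fun _ _ _ => 0⟩ : ClusterStep (F.P K) 𝔸 M k)) p emb) (Window γ) κ
        (fun n i => 8 * (Real.exp 1 * 9 * 64 * K₀ 64 8 ^ 2) * (4 * A / (ϱ * (ω ^ (n - i))⁻¹))) ∧
      FadingMemory (8 * (Real.exp 1 * 9 * 64 * K₀ 64 8 ^ 2) * (4 * A / ϱ)) ω
        (fun n i => 8 * (Real.exp 1 * 9 * 64 * K₀ 64 8 ^ 2) * (4 * A / (ϱ * (ω ^ (n - i))⁻¹))) :=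
  ne9_and_fadingMemory_functionalOn_of_coordHoloRadii F K _ p emb (fun _ _ => univ) (fun _ _ _ => mem_univ _) hA hr₁ hκ hrate hsmall hϱ hω
    (fun k i => ϱ * (ω ^ (k - i))⁻¹) (fun _ _ => mul_pos hϱ (inv_pos.2 (pow_pos hω _))) (fun _ _ _ => le_rfl)
    (coordHoloRadii_termlessTower F K (fun _ _ => univ) hA.le R fun k i => ϱ * (ω ^ (k - i))⁻¹)

end Rider

end YMDAG.N22.W1.CouplingRadii

end
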